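import Summits.BirchSwinnertonDyer.Rank1Residual.Additive.GordRankZeroUpperHalfTowerOfProp414
import Summits.BirchSwinnertonDyer.Rank1Residual.Additive.GordCycLowerBoundOfControlTamagawaSharp
import Summits.BirchSwinnertonDyer.Rank1Residual.Additive.GordCycLowerBoundClass
import Literature.NumberTheory.EllipticCurves.CyclotomicPAdicHeight
import HarnessLib

/-!
# X4♯(G-ord) ∩ `I₀*`, rank `0`: route 2's END of record with BOTH halves of control IN THE KERNEL —
# Delbourgo 2002 at `3` (`hDel3`) REMOVED from the lower half (T-CTL-TAM♯), Delbourgo 1998 Prop. 4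
# already removed from the upper half (T-CTL-UP); named facts SEVEN ↦ FIVE
# (team n1011, row T-CTL-END, seat p06 GEN 12, FILE 1; idle rule)

HONEST FRAMING (cell `b2b-bsdres-*`, team n1011, verbatim): prove what is provable now; shrink each
hard class to its core with data; no claim beyond stated classes. Research route on
CONSTRUCTION-SHAPED X4 / §I N10–N11; ASSEMBLY theorems only — no definition, no named fact, nothing
booked, no residual-map mark moved, no class closed. X4♯(G-ord) stays CONSTRUCTION-SHAPED; the typed
inputs of route 2's END (`BranchUnitCoeffAt`, the Selmer-count certificate `3 ^ b ≤ #Sel⁽³⁾(E/ℚ)`)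
stay exactly what they were. NOTHING of p10's / r2's / additive-p2's / additive-p4's files is edited
(twins). RIDER u-2 (referee-1 R12.1): Greenberg's Prop. 4.14 record is NEVER instantiated on
potentially supersingular rows (O5/O6) — X4♯(G-ord) (`TypeGOrd`) sits inside its printed scope.

## What and why

Route 2's `p = 3` END of record on the N11 (G-ord) niche rows,
`ClassX4Gord.bsdp_three_rankZero_of_katoHalf_of_coeffCert_of_pow_le_card_selmerGroup_of_nonAnomalous`
(`Additive/BudgetFromSelmerGroup`, SEVEN named facts) and its T-CTL-UP FILE 6 twin `…_of_prop414`
(SIX: `hDel98 ↦ ∅`), read the two halves of `BSD(E,3)` as follows: LOWER = Kato's half + ONE unit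
coefficient at index `b` + the Prop-4.14 budget `3 ^ b ≤ #Sel⁽³⁾` ⟹ `CycLowerLeadingTermAt W 3`
(`L(E,1)/Ω_E ∣ f(0)` for every generator `f` of `char_Λ X(E/ℚ_∞)`; p10's
`ClassX4Gord.cycLowerLeadingTermAt_of_katoHalf_of_coeffCert_of_budget_of_mod_four_eq_three`), then
**Delbourgo 2002 Thm. (A)+(B) at `3` (`hDel3`, A229) off the anomalous rows** to reach Miller's
`MissingLowerBoundAt W 3`; UPPER = Kato's component reading + Greenberg's Prop. 4.14 record + control
(T-CTL-UP). But the step `CycLowerLeadingTermAt ⟹ MissingLowerBoundAt` in rank `0` is ALSO a control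
theorem of this lineage: T-CTL-TAM FILE 7 (`GordCycLowerBoundOfControlTamagawaSharp`, p317742) proves
`CycLowerBoundAt W p Dh ⟹ MissingLowerBoundAt W p` on X4♯(G-ord) with NO named fact beyond GZK (the
sharp count `#𝒦_{v,0}[p^∞] ≤ c_v^{(p)}` at `v ∤ p`, p12's T-T3B socket `= ⊥` above `p`, `p ∤ #tors`
from `Irr`), and in rank `0` `CycLowerBoundAt W p Dh ⟺ CycLowerLeadingTermAt W p` for EVERY height
datum `Dh` (`cycLowerBoundAt_iff_cycLowerLeadingTermAt_of_rankZero`; we take the junk datum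
`PAdicHeightData.zero`). Composing:

* §1 `ClassX4Gord.missingLowerBoundAt_rankZero_of_cycLowerLeadingTerm_of_control` — X4♯(G-ord),
  `r_an = 0`, EVERY prime `p`: `CycLowerLeadingTermAt W p ⟹ MissingLowerBoundAt W p`, named facts {GZK}
  ONLY; NO anomaly clause, NO CM clause, NO Tamagawa clause (twin of p16's
  `ClassX4Gord.missingLowerBoundAt_three_rankZero_of_cycLower_of_nonAnomalous` {`hDel3`, GZK,
  modularity; `hcm`, `hna`} and of cc-typer-2's `p ≥ 5` A175 form); X3♯(G-ord), X4(M), X3♯(M) twins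
  (the (M) ones mod Tate's uniformisation `hT41`, A41 — as T-CTL-TAM FILE 7).
* §2 `ClassX4Gord.bsdp_rankZero_of_katoHalf_of_coeffCert_of_budget_of_prop414` — X4♯(G-ord) ∩ `I₀*`,
  `r_an = 0`, surj(p), `p ∤ Tam(E)`, EVERY odd `p`: `BSD(E,p)` ⟸ ONE unit coefficient at index `b` +
  `BudgetLeLambdaAt p W b`, named facts {Kato half `hK`, Pal 2012 `hPal` (`p ≡ 1 (mod 4)` only; the
  `…_of_mod_four_eq_three` form drops it), GZK, modularity `hmod`/`hmodD`, Prop. 4.14 `h414`} — NO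
  Delbourgo 1998, NO Delbourgo 2002, no anomaly / CM clause.
* §3 **`ClassX4Gord.bsdp_three_rankZero_of_katoHalf_of_coeffCert_of_pow_le_card_selmerGroup_of_prop414`**
  — the `p = 3` END-of-record twin: X4♯(G-ord) at `3` ∧ surj(3), `r_an = 0`, `3 ∤ Tam(E)`:
  `BSD(E,3)` ⟸ ONE 3-adic unit coefficient at index `b` + `3 ^ b ≤ #Sel⁽³⁾(E/ℚ)`, from the named facts
  {`hK`, GZK, `hmod`, `hmodD`, `h414`} — **FIVE**. Binder diff against the FILE 6 twin
  `…_of_nonAnomalous_of_prop414` (SIX): REMOVED {`hDel3 : Delbourgo2002.mainTheorem_three`,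
  `hna : ReductionNonAnomalous W 3`, `hcm : ¬ W.HasCM`}; ADDED ∅. Against route 2's END of record
  (SEVEN): REMOVED {`hDel98`, `hDel3`, `hna`, `hcm`}; ADDED {`S`, `hgood`, `hB : ¬ 3 ∣ W.tamagawaProduct`}
  (census place data and the `B = 0` row condition, met on 92466r1 / 240120f1 by kernel numerals).

So on the `B = 0` (G-ord) niche rows the additive-reduction-specific Iwasawa theory (Delbourgo 1998,
2002) is not an input any more: Kato's divisibility (Wuthrich's eigen-attribution), GZK, modularity,
Greenberg's Prop. 4.14 and the kernel's two control halves suffice. NOT claimed: `B ≥ 1` rows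
(437742q1: the upper half there wants either Delbourgo or the Tamagawa-exact Kato reading A161″ —
separate file on a consumer's word); anything in rank `1`. Axioms standard.

References: [Kato2004Asterisque] Thm. 17.4 (3); [Wuthrich2014] Cor. 19; [GreenbergLNM1716] §3 Lemma
3.3, §4 Thm. 4.1, Prop. 4.14; [Pal2012] Thm. 3.2; [SilvermanATAEC1994] Thm. V.5.3 (A41, (M) twins
only); [Delbourgo2002] Thm. (A)/(B) (REMOVED); [Delbourgo1998] Prop. 4 (REMOVED); [Miller2011LMS]
Def. 1.1; cells/n1011/ROUTE-2.md §II.48; cells/n1011/skel/T-CTL-END.md.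
-/

noncomputable section

open scoped Classical MatrixGroups ModularForm NumberField

open CongruenceSubgroup WeierstrassCurve NumberField Literature.NumberTheory.EllipticCurves
  Literature.NumberTheory.EllipticCurves.ModularForms
  Literature.NumberTheory.EllipticCurves.Rank1Residual
  Literature.NumberTheory.EllipticCurves.Rank1Residual.Typed
  Literature.NumberTheory.EllipticCurves.Delbourgo2002
  Literature.NumberTheory.GaloisRepresentations
  IsDedekindDomain Rat.HeightOneSpectrum
  Summit.BirchSwinnertonDyer.Rank1Residual.Iwasawa
  Summit.BirchSwinnertonDyer.Rank1Residual.AdditivePotMult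

namespace Summit.BirchSwinnertonDyer.Rank1Residual.Additive

variable {W : WeierstrassCurve ℚ} [W.IsElliptic] [W.IsGloballyMinimal] {p : ℕ} [hp : Fact p.Prime]

/-! ### §1 Rank `0`: `CycLowerLeadingTermAt ⟹ MissingLowerBoundAt` BY CONTROL (no Delbourgo 2002) -/

/-- **X4♯(G-ord), `r_an = 0`, EVERY prime `p`: the lower half `ord_p #Ш_an ≤ ord_p #Ш` from the
`T = 0` lower divisibility `CycLowerLeadingTermAt W p` BY CONTROL** — T-CTL-TAM FILE 7's
`ClassX4Gord.missingLowerBoundAt_rankZero_of_cycLowerBound_tamagawaSharp` (sharp Tamagawa count at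
`v ∤ p`, T-T3B socket `= ⊥` above `p`, `p ∤ #tors` from `Irr`) at the junk height datum, through the
rank-`0` bridge `cycLowerBoundAt_iff_cycLowerLeadingTermAt_of_rankZero`. Named facts: GZK only; NO
anomaly, CM or Tamagawa clause (cf. p16's `…_three_rankZero_of_cycLower_of_nonAnomalous`: `hDel3`,
`hcm`, `hna`). `S / hgood` = the census place list.
[cite: GreenbergLNM1716, §3 Lemma 3.3 (pp. 86–88), Lemma 3.5 (p. 90) and §4 Thm. 4.1 (pp. 102–104, p. 74)]
[cite: Miller2011LMS, Def. 1.1] -/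
theorem ClassX4Gord.missingLowerBoundAt_rankZero_of_cycLowerLeadingTerm_of_control
    (hX : ClassX4Gord W p) (hGZK : rank_eq_analyticRank_of_analyticRank_le_one)
    (hr : W.analyticRank = 0) (S : Finset (HeightOneSpectrum (𝓞 ℚ)))
    (hgood : ∀ v ∉ S, (p : 𝓞 ℚ) ∉ v.asIdeal ∧ W.HasGoodReductionAt v)
    (hLow : CycLowerLeadingTermAt W p) : MissingLowerBoundAt W p :=
  ClassX4Gord.missingLowerBoundAt_rankZero_of_cycLowerBound_tamagawaSharp hX hGZK hr S hgood
    (WeierstrassCurve.PAdicHeightData.zero W p)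
    ((cycLowerBoundAt_iff_cycLowerLeadingTermAt_of_rankZero hGZK hr _).mpr hLow)

/-- **X3♯(G-ord), `r_an = 0`, EVERY odd `p`, `p ∤ #E(ℚ)_tors` explicit: the lower half from
`CycLowerLeadingTermAt W p` BY CONTROL** (T-CTL-TAM FILE 7's X3♯ END at the junk height datum).
Named facts: GZK only. [cite: GreenbergLNM1716, §3 Lemma 3.3 (pp. 86–88), Lemma 3.5 (p. 90) and §4 Thm. 4.1 (pp. 102–104, p. 74)]
[cite: Miller2011LMS, Def. 1.1] -/
theorem ClassX3Gord.missingLowerBoundAt_rankZero_of_cycLowerLeadingTerm_of_control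
    (hp2 : p ≠ 2) (hX : ClassX3Gord W p) (hGZK : rank_eq_analyticRank_of_analyticRank_le_one)
    (hr : W.analyticRank = 0) (htors : ¬ p ∣ W.torsionOrder) (S : Finset (HeightOneSpectrum (𝓞 ℚ)))
    (hgood : ∀ v ∉ S, (p : 𝓞 ℚ) ∉ v.asIdeal ∧ W.HasGoodReductionAt v)
    (hLow : CycLowerLeadingTermAt W p) : MissingLowerBoundAt W p :=
  ClassX3Gord.missingLowerBoundAt_rankZero_of_cycLowerBound_tamagawaSharp hp2 hX hGZK hr htors S hgood
    (WeierstrassCurve.PAdicHeightData.zero W p)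
    ((cycLowerBoundAt_iff_cycLowerLeadingTermAt_of_rankZero hGZK hr _).mpr hLow)

/-- **X4(M), `r_an = 0`, EVERY prime `p`: the lower half from `CycLowerLeadingTermAt W p` BY CONTROL,
mod Tate's uniformisation `hT41` (A41, the socket above `p` = p12's T-T3M)** — twin of additive-p2's
`ClassX4M.missingLowerBoundAt_rankZero_of_cycLowerLeadingTerm` {`hDelX` (Delbourgo 1998 Lemma (ii) /
Prop. 4 exact), GZK, modularity}. Named facts: {A41, GZK}.
[cite: SilvermanATAEC1994, Ch. V Thm. 5.3, Cor. 5.4]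
[cite: GreenbergLNM1716, §3 Lemma 3.3 (pp. 86–88), Lemma 3.5 (p. 90) and §4 Thm. 4.1 (pp. 102–104, p. 74)]
[cite: Miller2011LMS, Def. 1.1] -/
theorem _root_.Summit.BirchSwinnertonDyer.Rank1Residual.AdditivePotMult.ClassX4M.missingLowerBoundAt_rankZero_of_cycLowerLeadingTerm_of_control
    (hT41 : Silverman1994_thmV53_corV54_tateUniformisation.{0})
    (hX : AdditivePotMult.ClassX4M W p) (hGZK : rank_eq_analyticRank_of_analyticRank_le_one)
    (hr : W.analyticRank = 0) (S : Finset (HeightOneSpectrum (𝓞 ℚ)))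
    (hgood : ∀ v ∉ S, (p : 𝓞 ℚ) ∉ v.asIdeal ∧ W.HasGoodReductionAt v)
    (hLow : CycLowerLeadingTermAt W p) : MissingLowerBoundAt W p :=
  ClassX4M.missingLowerBoundAt_rankZero_of_cycLowerBound_tamagawaSharp hT41 hX hGZK hr S hgood
    (WeierstrassCurve.PAdicHeightData.zero W p)
    ((cycLowerBoundAt_iff_cycLowerLeadingTermAt_of_rankZero hGZK hr _).mpr hLow)

/-- **X3♯(M), `r_an = 0`, EVERY prime `p`, `p ∤ #E(ℚ)_tors` explicit: the lower half from
`CycLowerLeadingTermAt W p` BY CONTROL, mod A41** (T-CTL-TAM FILE 7's X3♯(M) END at the junk height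
datum). Named facts: {A41, GZK}. [cite: SilvermanATAEC1994, Ch. V Thm. 5.3, Cor. 5.4]
[cite: GreenbergLNM1716, §3 Lemma 3.3 (pp. 86–88), Lemma 3.5 (p. 90) and §4 Thm. 4.1 (pp. 102–104, p. 74)]
[cite: Miller2011LMS, Def. 1.1] -/
theorem _root_.Summit.BirchSwinnertonDyer.Rank1Residual.AdditivePotMult.ClassX3M.missingLowerBoundAt_rankZero_of_cycLowerLeadingTerm_of_control
    (hT41 : Silverman1994_thmV53_corV54_tateUniformisation.{0})
    (hX : AdditivePotMult.ClassX3M W p) (hGZK : rank_eq_analyticRank_of_analyticRank_le_one)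
    (hr : W.analyticRank = 0) (htors : ¬ p ∣ W.torsionOrder) (S : Finset (HeightOneSpectrum (𝓞 ℚ)))
    (hgood : ∀ v ∉ S, (p : 𝓞 ℚ) ∉ v.asIdeal ∧ W.HasGoodReductionAt v)
    (hLow : CycLowerLeadingTermAt W p) : MissingLowerBoundAt W p :=
  ClassX3M.missingLowerBoundAt_rankZero_of_cycLowerBound_tamagawaSharp hT41 hX hGZK hr htors S hgood
    (WeierstrassCurve.PAdicHeightData.zero W p)
    ((cycLowerBoundAt_iff_cycLowerLeadingTermAt_of_rankZero hGZK hr _).mpr hLow)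

/-! ### §2 X4♯(G-ord) ∩ `I₀*`, EVERY odd `p`: `BSD(E,p)` from the certificate pair, BOTH halves by control -/

/-- **X4♯(G-ord) ∩ `I₀*` (`he : e = 2`), `r_an = 0`, surj(p), `p ∤ Tam(E)`, EVERY odd `p`: `BSD(E,p)` ⟸
ONE unit coefficient at index `b` (`BranchUnitCoeffAt W p b`) + the budget `BudgetLeLambdaAt p W b`**,
named facts {Kato half `hK`, Pal 2012 Thm. 3.2 `hPal` (enters only at `p ≡ 1 (mod 4)`), GZK,
modularity `hmod`/`hmodD`, Greenberg Prop. 4.14 `h414`} — LOWER = p10's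
`ClassX4Gord.cycLowerLeadingTermAt_of_katoHalf_of_coeffCert_of_budget` + §1; UPPER = T-CTL-UP FILE 6's
`ClassX4Gord.bsdp_rankZero_of_katoComponent_of_surj_of_lower_of_prop414` (certificate-free tower, Kato's
component reading derived from the half reading by
`Kato2004.charIdeal_dvd_padicLFunctionBranch_component_of_surjective_of_half`). NO Delbourgo 1998 /
2002, no anomaly / CM clause. `S / hgood` = census place list; `hB` = the `B = 0` row condition.
[cite: Kato2004Asterisque, Thm. 17.4 (3) (p. 273)] [cite: Pal2012, Thm. 3.2]
[cite: GreenbergLNM1716, §3 Lemma 3.3, §4 Thm. 4.1 (pp. 102–104) and Prop. 4.14 (p. 114)]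
[cite: Miller2011LMS, §1 and Def. 1.1] -/
theorem ClassX4Gord.bsdp_rankZero_of_katoHalf_of_coeffCert_of_budget_of_prop414
    (hK : Wuthrich2014.kato_halfEigenCharIdeal_dvd_cyclotomicPrime_of_surjective)
    (hPal : Pal2012.thm32_sqrt_mul_realPeriodRat_twist_eq_of_prime_one_mod_four)
    (hGZK : rank_eq_analyticRank_of_analyticRank_le_one) (hmod : hasEntireLFunction_rat)
    (hmodD : nonempty_modularParametrizationData)
    (h414 : Greenberg1999.prop414_noFiniteSubmodule_of_not_dvd_torsionOrder)
    (hX : ClassX4Gord W p) (he : semistabilityIndex W p = 2) (hsurj : Surj W p)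
    (hr : W.analyticRank = 0) {b : ℕ} (hcert : BranchUnitCoeffAt W p b) (hbud : BudgetLeLambdaAt p W b)
    (S : Finset (HeightOneSpectrum (𝓞 ℚ)))
    (hgood : ∀ v ∉ S, (p : 𝓞 ℚ) ∉ v.asIdeal ∧ W.HasGoodReductionAt v) (hB : ¬ p ∣ W.tamagawaProduct) :
    BSDp W p :=
  ClassX4Gord.bsdp_rankZero_of_katoComponent_of_surj_of_lower_of_prop414
    (Kato2004.charIdeal_dvd_padicLFunctionBranch_component_of_surjective_of_half hK) h414 hGZK hmod hmodD
    hX he hr hsurj S hgood hB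
    (hX.missingLowerBoundAt_rankZero_of_cycLowerLeadingTerm_of_control hGZK hr S hgood
      (hX.cycLowerLeadingTermAt_of_katoHalf_of_coeffCert_of_budget hK hPal hmod hmodD he hsurj hcert hbud))

/-- **The same at `p ≡ 3 (mod 4)` WITHOUT Pal 2012** (idle on the odd branch: p10's
`…_of_mod_four_eq_three`), named facts {`hK`, GZK, `hmod`, `hmodD`, `h414`}.
[cite: Kato2004Asterisque, Thm. 17.4 (3) (p. 273)]
[cite: GreenbergLNM1716, §3 Lemma 3.3, §4 Thm. 4.1 (pp. 102–104) and Prop. 4.14 (p. 114)]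
[cite: Miller2011LMS, §1 and Def. 1.1] -/
theorem ClassX4Gord.bsdp_rankZero_of_katoHalf_of_coeffCert_of_budget_of_prop414_of_mod_four_eq_three
    (hK : Wuthrich2014.kato_halfEigenCharIdeal_dvd_cyclotomicPrime_of_surjective)
    (hGZK : rank_eq_analyticRank_of_analyticRank_le_one) (hmod : hasEntireLFunction_rat)
    (hmodD : nonempty_modularParametrizationData)
    (h414 : Greenberg1999.prop414_noFiniteSubmodule_of_not_dvd_torsionOrder)
    (hX : ClassX4Gord W p) (he : semistabilityIndex W p = 2) (hsurj : Surj W p) (hp4 : p % 4 = 3)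
    (hr : W.analyticRank = 0) {b : ℕ} (hcert : BranchUnitCoeffAt W p b) (hbud : BudgetLeLambdaAt p W b)
    (S : Finset (HeightOneSpectrum (𝓞 ℚ)))
    (hgood : ∀ v ∉ S, (p : 𝓞 ℚ) ∉ v.asIdeal ∧ W.HasGoodReductionAt v) (hB : ¬ p ∣ W.tamagawaProduct) :
    BSDp W p :=
  ClassX4Gord.bsdp_rankZero_of_katoComponent_of_surj_of_lower_of_prop414
    (Kato2004.charIdeal_dvd_padicLFunctionBranch_component_of_surjective_of_half hK) h414 hGZK hmod hmodD
    hX he hr hsurj S hgood hB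
    (hX.missingLowerBoundAt_rankZero_of_cycLowerLeadingTerm_of_control hGZK hr S hgood
      (hX.cycLowerLeadingTermAt_of_katoHalf_of_coeffCert_of_budget_of_mod_four_eq_three hK hmod hmodD he
        hsurj hp4 hcert hbud))

/-! ### §3 Route 2's `p = 3` END of record, `{hDel98, hDel3} ↦ ∅` -/

/-- **X4♯(G-ord) at `3` ∧ surj(3), `r_an = 0`, `3 ∤ Tam(E)` (N11 (G-ord) niche rows 92466r1 /
240120f1, census status `OPEN:LOWER(pure)`): `BSD(E,3)` ⟸ ONE 3-adic unit coefficient at index `b` +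
`3 ^ b ≤ #Sel⁽³⁾(E/ℚ)`, with NEITHER Delbourgo 1998 Prop. 4 NOR Delbourgo 2002 at `3` in the fact list**
— the `_of_prop414` twin of route 2's END of record
`ClassX4Gord.bsdp_three_rankZero_of_katoHalf_of_coeffCert_of_pow_le_card_selmerGroup_of_nonAnomalous`
(p10 / r2, `BudgetFromSelmerGroup`) with BOTH control halves in the kernel. Named facts: Kato half
`hK`, GZK, modularity `hmod` / `hmodD`, Greenberg Prop. 4.14 `h414` — **FIVE** (the END of record has
these five AND `hDel98`, `hDel3`; T-CTL-UP FILE 6's twin has these five AND `hDel3`). Lower half =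
route 2's chain to `CycLowerLeadingTermAt W 3` verbatim (`hbud` from the Selmer count through `h414`,
the odd Λ-adic bridge, no Pal) + §1 (control, T-CTL-TAM♯); upper half = T-CTL-UP FILE 6 (tower from
surj(3), Prop. 4.14 + control). Binders REMOVED against the FILE 6 twin: `hDel3`, `hna`, `hcm`; ADDED:
none. Extra binders against the END of record: the census place data `S / hgood` and
`hB : ¬ 3 ∣ W.tamagawaProduct` (B = 0). [cite: Kato2004Asterisque, Thm. 17.4 (3) (p. 273)]
[cite: GreenbergLNM1716, §3 Lemma 3.3 (pp. 86–88), §4 Thm. 4.1 (pp. 102–104) and Prop. 4.14 (p. 114)]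
[cite: Miller2011LMS, §1 and Def. 1.1] -/
theorem ClassX4Gord.bsdp_three_rankZero_of_katoHalf_of_coeffCert_of_pow_le_card_selmerGroup_of_prop414
    [Fact (Nat.Prime 3)] {W : WeierstrassCurve ℚ} [W.IsElliptic] [W.IsGloballyMinimal]
    (hK : Wuthrich2014.kato_halfEigenCharIdeal_dvd_cyclotomicPrime_of_surjective)
    (hGZK : rank_eq_analyticRank_of_analyticRank_le_one) (hmod : hasEntireLFunction_rat)
    (hmodD : nonempty_modularParametrizationData)
    (h414 : Greenberg1999.prop414_noFiniteSubmodule_of_not_dvd_torsionOrder)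
    (hX : ClassX4Gord W 3) (hsurj : Surj W 3) (hr : W.analyticRank = 0)
    {b : ℕ} (hcert : BranchUnitCoeffAt W 3 b) (hSel : 3 ^ b ≤ Nat.card (selmerGroup W (3 : ℤ)))
    (S : Finset (HeightOneSpectrum (𝓞 ℚ)))
    (hgood : ∀ v ∉ S, ((3 : ℕ) : 𝓞 ℚ) ∉ v.asIdeal ∧ W.HasGoodReductionAt v)
    (hB : ¬ 3 ∣ W.tamagawaProduct) : BSDp W 3 :=
  ClassX4Gord.bsdp_rankZero_of_katoHalf_of_coeffCert_of_budget_of_prop414_of_mod_four_eq_three hK hGZK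
    hmod hmodD h414 hX (semistabilityIndex_eq_two_of_typeG_three W hX.typeGOrd.typeG hX.addv.2) hsurj rfl
    hr hcert
    (budgetLeLambdaAt_of_prop414_of_pow_le_card_selmerGroup h414 (not_dvd_torsionOrder_of_surj 3 W hsurj)
      hSel)
    S hgood hB

end Summit.BirchSwinnertonDyer.Rank1Residual.Additive

end
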